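import Literature.AnabelianGeometry.SemiGraphs.ThetaRayGraph
import HarnessLib

/-!
# `𝒢_θ`: assembling `Prop36Hypotheses` / `Thm37Hypotheses` from the bricks (FRONTIER programme
# «REFUTE-F1732», R3 support for R7)

Mochizuki, *Semi-graphs of anabelioids*, Publ. RIMS **42** (2006), Prop 3.6 p. 38 and Thm 3.7 p. 40 (the
standing hypotheses: "connected, countable, Galois-countable, quasi-coherent, totally elevated, totally
aloof [resp. estranged], verticially slim") [cite: MochizukiSemiAnbd2006, Thm 3.7 p.40].

PROOF-ONLY companion of `ThetaRayGraph.lean` (abc-iut cell, L3 FRONTIER programme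
`plan/L3/SUBDAG-SemiAnbd-Thm37iii-REFUTE.md`, brick R3, seat abc-iut-w6-d070).  HONEST FRAMING (α59): towards
a kernel erratum for the ∀-countable reading of [SemiAnbd] Thm 3.7 (iii); print proves the finite-`𝔾` case
(p431007).  This file asserts NOTHING about `𝒢_θ` beyond bookkeeping: it ASSEMBLES the hypothesis bundles
`Prop36Hypotheses` / `Thm37Hypotheses` of `thetaRay G E up low` from the (H1) facts of `ThetaRayGraph.lean`
(connected, countable, has a vertex, injective type) and the remaining fields TAKEN AS NAMED INPUTS — the
outputs of bricks R2 (`G` slim), R4 (Galois-countable, quasi-coherent), R5 (totally elevated, totally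
aloof / estranged) — so that brick R7 (`not_compactInVerticialAt_𝒢θ`) has ONE call site for `h37`.
No definition, no instance, no named fact; no side taken on [IUTchIII] Cor 3.12; typed ≠ proved.
-/

namespace Literature.AnabelianGeometry.SemiGraphs

namespace ProfiniteSemiGraph

section Hypotheses

variable (G E : Type) [Group G] [TopologicalSpace G] [IsTopologicalGroup G] [CompactSpace G]
  [TotallyDisconnectedSpace G] [Group E] [TopologicalSpace E] [IsTopologicalGroup E] [CompactSpace E]
  [TotallyDisconnectedSpace E] (up : E →ₜ* G) (low : ℕ → (E →ₜ* G))

/-- **`Prop36Hypotheses 𝒢_θ` assembled**: (H1) from `ThetaRayGraph.lean` (connected, countable, has a vertex,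
injective type from injective gluings), (H2) from `G` slim (brick R2), (H4)/(H5) Galois-countable and
quasi-coherent (brick R4) and the aloofness / elevation halves of (H3)/(H6) (brick R5) as named inputs.
[cite: MochizukiSemiAnbd2006, Prop 3.6 p.38] -/
theorem thetaRay_prop36Hypotheses (hup : Function.Injective up) (hlow : ∀ k, Function.Injective (low k))
    (hslim : Literature.AlgebraicGeometry.Frobenioids.IsSlimGroup G)
    (hGC : (thetaRay G E up low).IsGaloisCountable) (hQC : (thetaRay G E up low).IsQuasiCoherent)
    (hTE : (thetaRay G E up low).IsTotallyElevated) (hTA : (thetaRay G E up low).IsTotallyAloof) :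
    (thetaRay G E up low).Prop36Hypotheses where
  isConnected := thetaRay_isConnected G E up low
  isCountable := thetaRay_isCountable G E up low
  isGaloisCountable := hGC
  hasVertex := thetaRay_hasVertex G E up low
  isOfInjectiveType := thetaRay_isOfInjectiveType G E up low hup hlow
  isQuasiCoherent := hQC
  isTotallyElevated := hTE
  isTotallyAloof := hTA
  isVerticiallySlim := thetaRay_isVerticiallySlim G E up low hslim

/-- **`Thm37Hypotheses 𝒢_θ` assembled**: `Prop36Hypotheses` as above plus total estrangement (brick R5, from
brick R2's `A ⊓ g•A_n = ⊥` / malnormality). [cite: MochizukiSemiAnbd2006, Thm 3.7 p.40] -/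
theorem thetaRay_thm37Hypotheses (hup : Function.Injective up) (hlow : ∀ k, Function.Injective (low k))
    (hslim : Literature.AlgebraicGeometry.Frobenioids.IsSlimGroup G)
    (hGC : (thetaRay G E up low).IsGaloisCountable) (hQC : (thetaRay G E up low).IsQuasiCoherent)
    (hTE : (thetaRay G E up low).IsTotallyElevated) (hTA : (thetaRay G E up low).IsTotallyAloof)
    (hTEs : (thetaRay G E up low).IsTotallyEstranged) :
    (thetaRay G E up low).Thm37Hypotheses where
  toProp36Hypotheses := thetaRay_prop36Hypotheses G E up low hup hlow hslim hGC hQC hTE hTA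
  isTotallyEstranged := hTEs

end Hypotheses

section Twists

variable (G E : Type) [Group G] [TopologicalSpace G] [IsTopologicalGroup G] [CompactSpace G]
  [TotallyDisconnectedSpace G] [Group E] [TopologicalSpace E] [IsTopologicalGroup E] [CompactSpace E]
  [TotallyDisconnectedSpace E] (α : E →ₜ* G) (θ : ℕ → (G →ₜ* G)) (n : ℕ → ℕ)

/-- **`Thm37Hypotheses` for the memo's `𝒢_θ` with twists** (`low k = θ_{n_k} ∘ α`): the same assembly at
`thetaRayOfTwists G E α θ n`, injectivity of the gluings from `α` injective and the `θ_{n_k}` injective.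
[cite: MochizukiSemiAnbd2006, Thm 3.7 p.40] -/
theorem thetaRayOfTwists_thm37Hypotheses (hα : Function.Injective α) (hθ : ∀ k, Function.Injective (θ (n k)))
    (hslim : Literature.AlgebraicGeometry.Frobenioids.IsSlimGroup G)
    (hGC : (thetaRayOfTwists G E α θ n).IsGaloisCountable) (hQC : (thetaRayOfTwists G E α θ n).IsQuasiCoherent)
    (hTE : (thetaRayOfTwists G E α θ n).IsTotallyElevated) (hTA : (thetaRayOfTwists G E α θ n).IsTotallyAloof)
    (hTEs : (thetaRayOfTwists G E α θ n).IsTotallyEstranged) :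
    (thetaRayOfTwists G E α θ n).Thm37Hypotheses :=
  thetaRay_thm37Hypotheses G E α _ hα (fun k => (hθ k).comp hα) hslim hGC hQC hTE hTA hTEs

end Twists

end ProfiniteSemiGraph

end Literature.AnabelianGeometry.SemiGraphs
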